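import Mathlib
import Literature.MathematicalPhysics.QuantumFieldTheory.BalabanImbrieJaffe1984to88.BIJ85Sect4Statements

/-!
# `BalabanImbrieJaffe1984to88.BIJ85Prop522Proof` — T. Bałaban, J. Imbrie, A. Jaffe, *Renormalization of the Higgs model:
minimizers, propagators and the stability of mean field theory*, Commun. Math. Phys. **97** (1985) 299–329
[BalabanImbrieJaffe1985]: **Proposition 5.2.2** (5.2.6)–(5.2.7) p. 316 PROVED from its three printed inputs — (5.2.1)/(5.2.2)
(Proposition 5.2.1), (5.2.8), and Proposition 5.1.1 in the form (5.1.15) — via the printed intermediate identity (5.2.9); Remark 1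
(5.2.10) p. 317 as a corollary

statement-level skeleton of published theorems with citation tags; proofs where landed; nothing here is a claim about the Yang–Mills mass gap

PDF held: `paper:balaban1985-cmp97-bij-higgs-minimizers` (journal page = PDF page + 298); pp. 313–317 [PDF 15–19] read for this file.

CITATION HEADER (lean-in-tree rule).  Phase-2 proof seat p11 of the mega-formalization `lit-balaban` (HOME
`run/shared/lean/pub/lit-balaban/`), reserve row **R5** of `PHASE2-TARGETS.md` §G.3 (= SKELETON row **C1.Prop5.2.2**, decl of record
`BIJ85Sect4Statements.Prop522Data.Prop522`, typed p239474 by reader r15; r15's nomination P5: *"Prop. 5.2.2 from Prop. 5.2.1 + (5.2.8) +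
Prop. 5.1.1 as operator algebra over `Prop522Data` (the printed proof is three lines once λ_j's linearity is a field)"*).

THE PRINTED PROOF (p. 316 l. −3 – p. 317 l. 4), verbatim: *"Proof. We use three facts: the formula (5.2.1), the fact that
H*_{j,Ax}∂* = H*_j∂*, (5.2.8) is gauge invariant, and formulas (5.1.1), (5.1.4) for the factor H_{j,Ax} − H_j in the expression
G_{k,Ax}∂* − 𝒟_k∂* = Σ_{j=0}^{k−1} (H_{j,Ax} − H_j)C^{(j)}H*_j∂*. (5.2.9)  Substitution then yields (5.2.7)."*  The inputs, verbatim: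
(5.2.1)–(5.2.2) p. 316 *"The G_{k,Ax} satisfy the recursion relation G_{k,Ax} = H_{k−1,Ax}C^{(k−1)}H*_{k−1,Ax} + G_{k−1,Ax}, (5.2.1) with the
solution: G_{k,Ax} = Σ_{j=0}^{k−1} H_{j,Ax}C^{(j)}H*_{j,Ax}. (5.2.2)"*; (4.4.4) p. 312 *"𝒟_k ≡ Σ_{j=0}^{k−1} H_jC^{(j)}H_j*"*; (5.1.1) p. 313
*"H_{k,Ax}B − H_kB = ∂λ. (5.1.1) We show that λ is an explicit, linear function of H_kB"*, (5.1.15) p. 315 *"Thus H_{k,Ax}B = H_kB +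
∂λ(H_kB), and the proof of Proposition 5.1.1 is complete"*; (5.2.7) p. 316 *"D = Σ_{j=0}^{k−1} λ_j(H_jC^{(j)}H_j*∂*), (5.2.7) where λ_j is
the function of Proposition 5.1.1 with k set equal to j"*.

WHAT IS PROVED, and over what.  The carrier of record `Prop522Data` (one scale k: sources J, the COMPOSED operators G_{k,Ax}∂*, 𝒟_k∂*,
H_jC^{(j)}H_j*∂*, the gradient ∂ : Gauge →+ Field, and the gauge-function-valued maps λ_j(T)) does not carry the FACTORS of these
compositions; the printed proof manipulates the factors.  They enter here as explicit data of the theorems, exactly as the printed proof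
uses them (heterogeneous types: for each j an arbitrary type `V j` of "unit-lattice fields at scale j", the domain of H_j, H_{j,Ax} and of
C^{(j)}):
* `HaxsDs j` = H*_{j,Ax}∂*, `HsDs j` = H*_j∂* : `P.Field → V j`;  `C j` = C^{(j)} : `V j → V j`;  `Hax j` = H_{j,Ax}, `H j` = H_j : `V j →
  P.Field`;  `Λ j : P.Field → P.Gauge` = the gauge function λ_j of Prop. 5.1.1 (k := j) *"as a linear function of H_jB"* ((5.1.1),
  (5.1.15): H_{j,Ax}B = H_jB + ∂λ_j(H_jB) — hypothesis `h511`), and the READING of the carrier's notation λ_j(T) of (5.2.7): λ_j(T)J =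
  λ_j evaluated at TJ in place of H_jB (hypothesis `hlam`, stated only for the operators T = H_jC^{(j)}H_j*∂* that (5.2.7) uses);
* the hypotheses `h522` / `h444` say that the carrier's G_{k,Ax}∂* and 𝒟_k∂* ARE the compositions (5.2.2)∘∂* and (4.4.4)∘∂*, `hHCH` that
  its H_jC^{(j)}H_j*∂* is the composition, `h528` is (5.2.8).
Then: `eq529` = **(5.2.9)**; `prop522_holds` = **Prop. 5.2.2** (`P.Prop522`, i.e. (5.2.6) with the D of (5.2.7)) — *"Substitution then
yields (5.2.7)"*; `prop522_holds_of_recursion` = the same from the RECURSION (5.2.1) for the sequence k′ ↦ G_{k′,Ax}∂* (G_{0,Ax} = 0, the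
empty sum), the step "(5.2.1) ⇔ (5.2.2)" being Prop. 5.2.1 (`BIJ85Sect4Statements.prop521_iff` is its ring form; here the operators
are maps between different types, so the three-line induction is re-run); `prop522_ring` = the instance in which all factors live in
one ring `R` acting on the sources, where (5.2.2)/(4.4.4) are LITERALLY the tree's `BIJ85Sect4Statements.curlyD` and Prop. 5.2.1 is
LITERALLY `prop521_iff`; `eq5210` = **Remark 1 (5.2.10)** ∂G_{k,Ax}∂* = ∂𝒟_k∂*, from (5.2.6) and ∂∂ = 0 (curl of a gradient), for any
additive `curl` with `curl ∘ P.grad = 0`.  No linearity of λ_j is needed for the algebra (only the additivity of ∂, which the carrier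
has); no functional integral, no lattice.  Carrier clauses (F6): the identification of the abstract operators with the printed
Gaussian-integral objects ((4.1.1), (4.1.3), (4.3.3), (4.4.2)) and the printed proofs of the INPUTS ((5.2.3)–(5.2.5) for (5.2.1);
(5.1.5)–(5.1.15) for Prop. 5.1.1; the gauge invariance behind (5.2.8)) are the instance's — rows C1.Prop5.2.1, C1.Eq5.1.5-5.1.15 of
SKELETON.md.  Axioms: the standard three.  Unit `lit-balaban-p11` (literature-prover-lit-balaban-p11-0).
-/

namespace Literature.MathematicalPhysics.QuantumFieldTheory.BalabanImbrieJaffe1984to88.BIJ85Prop522Proof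

open Finset BIJ85Sect4Statements

universe u

variable (P : Prop522Data) {V : ℕ → Type u}
  (Hax H : ∀ j, V j → P.Field) (C : ∀ j, V j → V j) (HaxsDs HsDs : ∀ j, P.Field → V j)
  (Λ : ℕ → P.Field → P.Gauge)

/-- **(5.2.9)** p. 317 [PDF 19], verbatim: *"… for the factor H_{j,Ax} − H_j in the expression G_{k,Ax}∂* − 𝒟_k∂* = Σ_{j=0}^{k−1}
(H_{j,Ax} − H_j)C^{(j)}H*_j∂*. (5.2.9)"* — from (5.2.2) composed with ∂* (`h522`), the definition (4.4.4) of 𝒟_k composed with ∂*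
(`h444`), and (5.2.8) H*_{j,Ax}∂* = H*_j∂* (`h528`, j < k).  Operator algebra over the carrier `Prop522Data` with the factors as
explicit data (see the module docstring). [cite: BalabanImbrieJaffe1985, (5.2.9) p.317] -/
theorem eq529
    (h522 : ∀ J, P.GaxDs J = ∑ j ∈ range P.k, Hax j (C j (HaxsDs j J)))
    (h444 : ∀ J, P.DkDs J = ∑ j ∈ range P.k, H j (C j (HsDs j J)))
    (h528 : ∀ j < P.k, ∀ J, HaxsDs j J = HsDs j J) (J : P.Field) :
    P.GaxDs J - P.DkDs J = ∑ j ∈ range P.k, (Hax j (C j (HsDs j J)) - H j (C j (HsDs j J))) := by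
  rw [h522 J, h444 J, ← Finset.sum_sub_distrib]
  refine Finset.sum_congr rfl fun j hj => ?_
  rw [h528 j (Finset.mem_range.mp hj) J]

/-- **Proposition 5.2.2** p. 316 [PDF 18], verbatim: *"There is a gauge transformation D such that G_{k,Ax}∂* − 𝒟_k∂* = ∂D. (5.2.6)
Explicitly D = Σ_{j=0}^{k−1} λ_j(H_jC^{(j)}H_j*∂*), (5.2.7) where λ_j is the function of Proposition 5.1.1 with k set equal to j.
Here we write the operator identity, rather than the identity G_{k,Ax}∂*B = 𝒟_k∂*B + ∂DB for configurations."* — the decl of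
record `Prop522Data.Prop522` PROVED by the printed proof p. 316–317: (5.2.9) (`eq529`: inputs (5.2.2), (4.4.4), (5.2.8)), then
Proposition 5.1.1 with k := j in the form (5.1.15) *"H_{k,Ax}B = H_kB + ∂λ(H_kB)"*, λ_j a function `Λ j` of H_jB (`h511`), and
*"Substitution then yields (5.2.7)"*: the carrier's λ_j(T) at T = H_jC^{(j)}H_j*∂* is λ_j evaluated at TJ (`hlam`, with `hHCH`
identifying the carrier's composed operator), the sum passing through the additive ∂.
[cite: BalabanImbrieJaffe1985, Prop. 5.2.2 (5.2.6) p.316] -/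
theorem prop522_holds
    (h522 : ∀ J, P.GaxDs J = ∑ j ∈ range P.k, Hax j (C j (HaxsDs j J)))
    (h444 : ∀ J, P.DkDs J = ∑ j ∈ range P.k, H j (C j (HsDs j J)))
    (h528 : ∀ j < P.k, ∀ J, HaxsDs j J = HsDs j J)
    (hHCH : ∀ j < P.k, ∀ J, P.HCHDs j J = H j (C j (HsDs j J)))
    (h511 : ∀ j < P.k, ∀ B : V j, Hax j B - H j B = P.grad (Λ j (H j B)))
    (hlam : ∀ j < P.k, ∀ J, P.lamOp j (P.HCHDs j) J = Λ j (P.HCHDs j J)) :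
    P.Prop522 := by
  intro J
  rw [eq529 P Hax H C HaxsDs HsDs h522 h444 h528 J, Prop522Data.D527, map_sum]
  refine Finset.sum_congr rfl fun j hj => ?_
  have hjk : j < P.k := Finset.mem_range.mp hj
  rw [h511 j hjk, hlam j hjk J, hHCH j hjk J]

/-- **Proposition 5.2.2 from the recursion (5.2.1)** (p. 316 [PDF 18]): the printed proof names *"the formula (5.2.1)"* as its
first input; with the SEQUENCE k′ ↦ G_{k′,Ax}∂* (`GaxDsSeq`, G_{0,Ax}∂* = 0 — the empty sum; in print k ≥ 1) satisfying the
recursion (5.2.1) composed with ∂*, *"Clearly (5.2.1) and (5.2.2) are equivalent"* (Proposition 5.2.1; ring form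
`BIJ85Sect4Statements.prop521_iff`) gives (5.2.2) at k′ = k, and `prop522_holds` applies.
[cite: BalabanImbrieJaffe1985, Prop. 5.2.2 (5.2.6)–(5.2.7) p.316] -/
theorem prop522_holds_of_recursion (GaxDsSeq : ℕ → P.Field → P.Field)
    (h0 : ∀ J, GaxDsSeq 0 J = 0)
    (h521 : ∀ k J, GaxDsSeq (k + 1) J = Hax k (C k (HaxsDs k J)) + GaxDsSeq k J)
    (hk : ∀ J, P.GaxDs J = GaxDsSeq P.k J)
    (h444 : ∀ J, P.DkDs J = ∑ j ∈ range P.k, H j (C j (HsDs j J)))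
    (h528 : ∀ j < P.k, ∀ J, HaxsDs j J = HsDs j J)
    (hHCH : ∀ j < P.k, ∀ J, P.HCHDs j J = H j (C j (HsDs j J)))
    (h511 : ∀ j < P.k, ∀ B : V j, Hax j B - H j B = P.grad (Λ j (H j B)))
    (hlam : ∀ j < P.k, ∀ J, P.lamOp j (P.HCHDs j) J = Λ j (P.HCHDs j J)) :
    P.Prop522 := by
  -- Proposition 5.2.1: the recursion (5.2.1) solves to the sum (5.2.2), for every k′
  have h522seq : ∀ k J, GaxDsSeq k J = ∑ j ∈ range k, Hax j (C j (HaxsDs j J)) := by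
    intro k
    induction k with
    | zero => intro J; simp [h0]
    | succ k ih => intro J; rw [h521, ih, Finset.sum_range_succ, add_comm]
  exact prop522_holds P Hax H C HaxsDs HsDs Λ (fun J => (hk J).trans (h522seq P.k J)) h444 h528 hHCH h511 hlam

/-- **Proposition 5.2.2 in one ring of operators** (p. 316 [PDF 18]): all factors H_{j,Ax}, H_j, C^{(j)}, H*_{j,Ax}, H*_j, ∂* in a ring
`R` acting on the sources; then (5.2.2) and (4.4.4) are LITERALLY the tree's `BIJ85Sect4Statements.curlyD` (G_{k,Ax} = `curlyD Hax C
Haxs k`, 𝒟_k = `curlyD H C Hs k`), Proposition 5.2.1 is LITERALLY `BIJ85Sect4Statements.prop521_iff` (used here on the recursion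
(5.2.1) for the sequence `Gax`, G_{0,Ax} = 0), (5.2.8) reads `Haxs j * Ds = Hs j * Ds`, and Prop. 5.1.1 (k := j) reads
`(Hax j − H j) • B = ∂(λ_j(H_j • B))`. [cite: BalabanImbrieJaffe1985, Prop. 5.2.2 (5.2.6)–(5.2.7) p.316] -/
theorem prop522_ring {R : Type*} [Ring R] [Module R P.Field]
    (Gax Hax H C Haxs Hs : ℕ → R) (Ds : R) (Λ : ℕ → P.Field → P.Gauge)
    (h0 : Gax 0 = 0) (h521 : ∀ k, Gax (k + 1) = Hax k * C k * Haxs k + Gax k)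
    (hGax : ∀ J, P.GaxDs J = (Gax P.k * Ds) • J)
    (hDk : ∀ J, P.DkDs J = (curlyD H C Hs P.k * Ds) • J)
    (h528 : ∀ j < P.k, Haxs j * Ds = Hs j * Ds)
    (hHCH : ∀ j < P.k, ∀ J, P.HCHDs j J = (H j * C j * Hs j * Ds) • J)
    (h511 : ∀ j < P.k, ∀ B : P.Field, (Hax j - H j) • B = P.grad (Λ j (H j • B)))
    (hlam : ∀ j < P.k, ∀ J, P.lamOp j (P.HCHDs j) J = Λ j (P.HCHDs j J)) :
    P.Prop522 := by
  -- Proposition 5.2.1 (`prop521_iff`): (5.2.1) ⇔ (5.2.2)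
  have h522 : ∀ k, Gax k = curlyD Hax C Haxs k := (prop521_iff Gax Hax C Haxs h0).mp h521
  refine prop522_holds P (V := fun _ => P.Field) (fun j B => Hax j • B) (fun j B => H j • B) (fun j B => C j • B)
    (fun j J => (Haxs j * Ds) • J) (fun j J => (Hs j * Ds) • J) Λ ?_ ?_ ?_ ?_ ?_ hlam
  · intro J
    rw [hGax J, h522 P.k, curlyD, Finset.sum_mul, Finset.sum_smul]
    refine Finset.sum_congr rfl fun j _ => ?_
    simp only [mul_smul]
  · intro J
    rw [hDk J, curlyD, Finset.sum_mul, Finset.sum_smul]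
    refine Finset.sum_congr rfl fun j _ => ?_
    simp only [mul_smul]
  · intro j hj J
    rw [h528 j hj]
  · intro j hj J
    rw [hHCH j hj J]
    simp only [mul_smul]
  · intro j hj B
    rw [← h511 j hj B, sub_smul]

/-- **Remark 1, (5.2.10)** p. 317 [PDF 19], verbatim: *"Remark 1. A consequence of the proposition is ∂G_{k,Ax}∂* = ∂𝒟_k∂*.
(5.2.10)"* — from (5.2.6) (`P.Prop522`) by applying the curl ∂ (any additive `curl` on the sources with ∂∂ = 0, i.e.
`curl ∘ P.grad = 0`: the curl of a gradient vanishes). [cite: BalabanImbrieJaffe1985, (5.2.10) p.317] -/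
theorem eq5210 {W : Type*} [AddCommGroup W] (curl : P.Field →+ W) (hcurl_grad : ∀ μ : P.Gauge, curl (P.grad μ) = 0)
    (h522 : P.Prop522) (J : P.Field) : curl (P.GaxDs J) = curl (P.DkDs J) := by
  have h := congrArg curl (h522 J)
  rw [map_sub, hcurl_grad, sub_eq_zero] at h
  exact h

end Literature.MathematicalPhysics.QuantumFieldTheory.BalabanImbrieJaffe1984to88.BIJ85Prop522Proof
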